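import Summits.ValiantsHypothesis.ValiantsHypothesis.Theses.RigidMinimalReps
import Summits.ValiantsHypothesis.ValiantsHypothesis.Theorems.RigidMinimalRepsTorusBound
import Literature.Computability.AlgebraicComplexity.GrenetEquivariant
import Literature.Computability.AlgebraicComplexity.PermanentVsDeterminantProofs
import Literature.Computability.AlgebraicComplexity.LRPencilOfMatrix

/-!
# Crux `RigidMinimalReps.MinimalRepTorusSymmetric` (stmt-ValiantsHypothesis-5112), line `birth` —
# Grenet's representation is TIGHT, and the converse of the line: the crux implies `stub_subPotentials`

Two facts that calibrate the line `birth` (whose remaining stub `stub_subPotentials` says: for all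
large `n`, SOME optimal affine determinantal representation of `per_n` admits a two-sided
sub-potential `α, β`):

* `grenet_repr_tight` — Grenet's `(2ⁿ - 1) × (2ⁿ - 1)` matrix (`Grenet.repr`, tree) is T-BIGRADED: with
  the vertex weights `w(S) = (𝟙_S, 𝟙_{[0,|S|)}) ∈ ℤⁿ × ℤⁿ` of its branching program, the potentials
  `α i = -w(row vertex)`, `β j = w(column vertex)` are TIGHT — a constant sits only on the diagonal
  `S = T` (`α + β = 0`), the variable `x_{(j,|S|)}` only on the arc `S → insert j S`
  (`α + β = w(insert j S) - w(S) = (e_j, e_{|S|})`), and `Σ α + Σ β = w(univ) - w(∅) = 𝟙`.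
* `subPotentials_of_minimalRepTorusSymmetric` — the CONVERSE of the line's reduction: the crux `X`
  implies the statement of `stub_subPotentials`.  Proof: `X` at `n ≥ 3` plus the PROVED sibling crux
  `TorusBound` (`torusBound_proof`) give `2ⁿ - 1 ≤ dc(per_n)`; Grenet's upper bound
  (`determinantalComplexity_perPoly_le_holds`) gives equality; so Grenet's matrix IS an optimal
  representation, and it carries the tight (a fortiori sub-) potentials above
  (`subPotentials_at_of_dc_eq`).

Together with `minimalRepTorusSymmetric_of_subPotentials` (file `…Reduction.lean`) this shows that the
line's heart `stub_subPotentials` is EQUIVALENT to the crux by tree theorems (and hence, by the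
strategist's calibration, to eventual Grenet optimality `dc(per_n) = 2ⁿ - 1`): the line `birth` has
no residual content below the crux.
[cite: Grenet2011, Thm. 1] [cite: LandsbergRessayre2017, §2.2, Thm. 2.8]
-/

-- Sub = Summit single-conjunct layout: the duplicated namespace component is mandated by the tree.
set_option linter.dupNamespace false

noncomputable section

namespace Summit.ValiantsHypothesis.ValiantsHypothesis.Theorems.RigidMinimalRepsMinimalRepTorusSymmetric

open Matrix MvPolynomial Finset
open Literature.Computability.AlgebraicComplexity LRPencil

variable {n : ℕ}

/-! ### The support of Grenet's matrix -/

/-- Grenet's adjacency entries have no constant term (they are sums of variables).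
[cite: Grenet2011, Thm. 1] -/
theorem constantCoeff_grenet_adj (S T : Finset (Fin n)) :
    constantCoeff (Grenet.adj ℂ n S T) = 0 := by
  rw [Grenet.adj_apply, map_sum]
  refine sum_eq_zero fun j _ => ?_
  split_ifs
  · unfold Grenet.wt
    split_ifs <;> simp
  · simp

/-- The variable `x_v` occurs in the adjacency entry `adj S T` only on the arc
`S → T = insert v.1 S` (`v.1 ∉ S`) and only with column index `v.2 = |S|`.
[cite: Grenet2011, Thm. 1] -/
theorem coeff_single_grenet_adj_ne_zero {S T : Finset (Fin n)} {v : Fin n × Fin n}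
    (h : coeff (Finsupp.single v 1) (Grenet.adj ℂ n S T) ≠ 0) :
    v.1 ∉ S ∧ T = insert v.1 S ∧ (v.2 : ℕ) = S.card := by
  rw [Grenet.adj_apply, coeff_sum] at h
  obtain ⟨j, -, hj⟩ := exists_ne_zero_of_sum_ne_zero h
  split_ifs at hj with hcond
  · obtain ⟨hjS, rfl⟩ := hcond
    unfold Grenet.wt at hj
    rw [dif_pos (Grenet.card_lt_of_notMem hjS), coeff_X] at hj
    split_ifs at hj with hv
    · have hv' : (j, (⟨S.card, Grenet.card_lt_of_notMem hjS⟩ : Fin n)) = v :=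
        Finsupp.single_left_injective one_ne_zero hv
      obtain ⟨rfl⟩ : (j, (⟨S.card, Grenet.card_lt_of_notMem hjS⟩ : Fin n)) = v := hv'
      exact ⟨hjS, rfl, rfl⟩
    · exact absurd rfl hj
  · exact absurd (coeff_zero _) hj

/-- Entries of Grenet's matrix: `± (δ_{S,T} - adj S T)` at the row vertex
`S = e⁻¹(succAbove (e univ) i)` and column vertex `T = e⁻¹(succAbove (e ∅) j)`.
[cite: Grenet2011, Thm. 1] -/
theorem grenet_repr_apply {N : ℕ} (e : Finset (Fin n) ≃ Fin (N + 1)) (i j : Fin N) :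
    Grenet.repr ℂ n e i j = C ((-1 : ℂ) ^ ((e univ : ℕ) + (e ∅ : ℕ))) *
      ((1 : Matrix (Finset (Fin n)) (Finset (Fin n)) (MvPolynomial (Fin n × Fin n) ℂ))
          (e.symm ((e univ).succAbove i)) (e.symm ((e ∅).succAbove j)) -
        Grenet.adj ℂ n (e.symm ((e univ).succAbove i)) (e.symm ((e ∅).succAbove j))) := by
  rw [map_pow, map_neg, map_one]
  rfl

/-- A constant of Grenet's matrix sits only on the diagonal `S = T` of the vertex sets.
[cite: Grenet2011, Thm. 1] -/
theorem grenet_constPart_ne_zero {N : ℕ} (e : Finset (Fin n) ≃ Fin (N + 1)) {i j : Fin N}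
    (h : constPart (Grenet.repr ℂ n e) i j ≠ 0) :
    e.symm ((e univ).succAbove i) = e.symm ((e ∅).succAbove j) := by
  by_contra hST
  apply h
  rw [constPart_apply, grenet_repr_apply, map_mul, map_sub, constantCoeff_grenet_adj,
    Matrix.one_apply_ne hST, map_zero, sub_zero, mul_zero]

/-- The variable `x_v` occurs in Grenet's matrix only on an arc `S → insert v.1 S` with `v.1 ∉ S`
and `v.2 = |S|`. [cite: Grenet2011, Thm. 1] -/
theorem grenet_coeffMat_ne_zero {N : ℕ} (e : Finset (Fin n) ≃ Fin (N + 1)) {i j : Fin N}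
    {v : Fin n × Fin n} (h : coeffMat (Grenet.repr ℂ n e) v i j ≠ 0) :
    v.1 ∉ e.symm ((e univ).succAbove i) ∧
      e.symm ((e ∅).succAbove j) = insert v.1 (e.symm ((e univ).succAbove i)) ∧
      (v.2 : ℕ) = (e.symm ((e univ).succAbove i)).card := by
  apply coeff_single_grenet_adj_ne_zero
  intro h0
  apply h
  rw [coeffMat_apply, grenet_repr_apply, coeff_C_mul, coeff_sub, h0, sub_zero, Matrix.one_apply]
  split_ifs
  · rw [← C_1, coeff_C, if_neg (fun h1 => one_ne_zero (Finsupp.single_eq_zero.1 h1.symm)), mul_zero]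
  · rw [coeff_zero, mul_zero]

/-! ### Grenet's matrix is tight -/

/-- **Grenet's representation is T-bigraded (tight).**  With the vertex weights
`w(S) = (𝟙_S, 𝟙_{[0,|S|)})`, the potentials `α i = -w(S_i)` (row vertices `S_i ≠ univ`) and
`β j = w(T_j)` (column vertices `T_j ≠ ∅`) satisfy: a constant sits only where `α i + β j = 0`, the
variable `x_{kl}` only where `α i + β j = (e_k, e_l)`, and `Σ α + Σ β = w(univ) - w(∅) = 𝟙`.
[cite: Grenet2011, Thm. 1] [cite: LandsbergRessayre2017, §2.2] -/
theorem grenet_repr_tight {N : ℕ} (e : Finset (Fin n) ≃ Fin (N + 1)) :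
    ∃ α β : Fin N → (Fin n → ℤ) × (Fin n → ℤ),
      (∀ i j, constPart (Grenet.repr ℂ n e) i j ≠ 0 → α i + β j = 0) ∧
      (∀ i j (v : Fin n × Fin n), coeffMat (Grenet.repr ℂ n e) v i j ≠ 0 →
        α i + β j = ((Pi.single v.1 1 : Fin n → ℤ), (Pi.single v.2 1 : Fin n → ℤ))) ∧
      ∑ i, α i + ∑ j, β j = 1 := by
  classical
  -- the vertex weights of Grenet's branching program
  set w : Finset (Fin n) → (Fin n → ℤ) × (Fin n → ℤ) :=
    fun S => (fun k => if k ∈ S then 1 else 0, fun c => if (c : ℕ) < S.card then 1 else 0) with hw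
  refine ⟨fun i => -w (e.symm ((e univ).succAbove i)), fun j => w (e.symm ((e ∅).succAbove j)),
    ?_, ?_, ?_⟩
  · -- constants: only on `S = T`
    intro i j h
    simp only
    rw [grenet_constPart_ne_zero e h]
    exact neg_add_cancel _
  · -- variables: only on arcs `S → insert v.1 S`, `v.2 = |S|`
    intro i j v h
    obtain ⟨hv1, hT, hv2⟩ := grenet_coeffMat_ne_zero e h
    simp only
    rw [hT, hw]
    refine Prod.ext (funext fun k => ?_) (funext fun c => ?_)
    · simp only [Prod.fst_add, Prod.fst_neg, Pi.add_apply, Pi.neg_apply, mem_insert, Pi.single_apply]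
      by_cases hk : k = v.1
      · subst hk
        simp [hv1]
      · simp [hk]
    · simp only [Prod.snd_add, Prod.snd_neg, Pi.add_apply, Pi.neg_apply, card_insert_of_notMem hv1,
        Pi.single_apply]
      have hc : (c = v.2) ↔ (c : ℕ) = (e.symm ((e univ).succAbove i)).card := by
        rw [Fin.ext_iff, hv2]
      by_cases hcv : c = v.2
      · rw [if_pos hcv]
        have := hc.1 hcv
        rw [if_neg (by omega), if_pos (by omega)]
        simp
      · rw [if_neg hcv]
        have := mt hc.2 hcv
        by_cases hlt : (c : ℕ) < (e.symm ((e univ).succAbove i)).card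
        · rw [if_pos hlt, if_pos (by omega)]; simp
        · rw [if_neg hlt, if_neg (by omega)]; simp
  · -- the sum telescopes to `w univ - w ∅ = 𝟙`
    have hrow : ∑ i : Fin N, w (e.symm ((e univ).succAbove i)) = ∑ q, w (e.symm q) - w univ := by
      rw [Fin.sum_univ_succAbove (fun q => w (e.symm q)) (e univ), e.symm_apply_apply]
      abel
    have hcol : ∑ j : Fin N, w (e.symm ((e ∅).succAbove j)) = ∑ q, w (e.symm q) - w ∅ := by
      rw [Fin.sum_univ_succAbove (fun q => w (e.symm q)) (e ∅), e.symm_apply_apply]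
      abel
    simp only [sum_neg_distrib]
    rw [hrow, hcol]
    have h1 : w univ - w ∅ = 1 := by
      rw [hw]
      refine Prod.ext (funext fun k => ?_) (funext fun c => ?_)
      · simp
      · simp
    rw [← h1]
    abel

/-! ### The converse of the line: the crux implies `stub_subPotentials` -/

/-- If `dc(per_n) = 2ⁿ - 1` (`n ≥ 1`) then the statement of `stub_subPotentials` holds at `n`: Grenet's
matrix is an optimal representation with tight, a fortiori sub-, potentials.
[cite: Grenet2011, Thm. 1] -/
theorem subPotentials_at_of_dc_eq (hn : n ≠ 0)
    (hdc : determinantalComplexity (perPoly (Fin n) ℂ) = 2 ^ n - 1)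
    (s : ℕ) (hs : determinantalComplexity (perPoly (Fin n) ℂ) = s) :
    ∃ A : Matrix (Fin s) (Fin s) (MvPolynomial (Fin n × Fin n) ℂ),
      IsAffineDetRepr (perPoly (Fin n) ℂ) A ∧
      ∃ α β : Fin s → (Fin n → ℤ) × (Fin n → ℤ),
        (∀ i j, constPart A i j ≠ 0 → α i + β j ≤ 0) ∧
        (∀ i j (v : Fin n × Fin n), coeffMat A v i j ≠ 0 →
          α i + β j ≤ ((Pi.single v.1 1 : Fin n → ℤ), (Pi.single v.2 1 : Fin n → ℤ))) ∧
        ∑ i, α i + ∑ j, β j = 1 := by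
  have hN : 2 ^ n = s + 1 := by have := @Nat.one_le_two_pow n; omega
  have hcard : Fintype.card (Finset (Fin n)) = s + 1 := by
    rw [Fintype.card_finset, Fintype.card_fin, hN]
  obtain ⟨e⟩ : Nonempty (Finset (Fin n) ≃ Fin (s + 1)) := ⟨Fintype.equivFinOfCardEq hcard⟩
  obtain ⟨α, β, h0, h1, hsum⟩ := grenet_repr_tight (n := n) e
  exact ⟨Grenet.repr ℂ n e, Grenet.isAffineDetRepr_repr ℂ n hn hN e, α, β,
    fun i j h => (h0 i j h).le, fun i j v h => (h1 i j v h).le, hsum⟩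

/-- **The crux implies the line's heart.**  `MinimalRepTorusSymmetric` (some optimal representation
of `per_n`, `n` large, is two-sided-torus equivariant) implies the statement of `stub_subPotentials`
(some optimal representation admits a two-sided sub-potential): by the proved sibling crux
`TorusBound` an equivariant representation has size `≥ 2ⁿ - 1`, so `dc(per_n) = 2ⁿ - 1` (Grenet's
upper bound), and Grenet's matrix is an optimal, tight representation.  With
`minimalRepTorusSymmetric_of_subPotentials` this makes `stub_subPotentials` EQUIVALENT to the crux.
[cite: LandsbergRessayre2017, Thm. 2.8] [cite: Grenet2011, Thm. 1] -/
theorem subPotentials_of_minimalRepTorusSymmetric :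
    Summit.ValiantsHypothesis.ValiantsHypothesis.Theses.RigidMinimalReps.MinimalRepTorusSymmetric →
    ∃ n₀ : ℕ, ∀ n ≥ n₀, ∀ s : ℕ, determinantalComplexity (perPoly (Fin n) ℂ) = s →
      ∃ A : Matrix (Fin s) (Fin s) (MvPolynomial (Fin n × Fin n) ℂ),
        IsAffineDetRepr (perPoly (Fin n) ℂ) A ∧
        ∃ α β : Fin s → (Fin n → ℤ) × (Fin n → ℤ),
          (∀ i j, constPart A i j ≠ 0 → α i + β j ≤ 0) ∧
          (∀ i j (v : Fin n × Fin n), coeffMat A v i j ≠ 0 →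
            α i + β j ≤ ((Pi.single v.1 1 : Fin n → ℤ), (Pi.single v.2 1 : Fin n → ℤ))) ∧
          ∑ i, α i + ∑ j, β j = 1 := by
  rintro ⟨n₀, hn₀⟩
  refine ⟨max n₀ 3, fun n hn s hs => ?_⟩
  have h3 : 3 ≤ n := le_trans (le_max_right _ _) hn
  obtain ⟨A, hA⟩ := hn₀ n (le_trans (le_max_left _ _) hn)
  have hlow : 2 ^ n - 1 ≤ determinantalComplexity (perPoly (Fin n) ℂ) :=
    RigidMinimalRepsTorusBound.torusBound_proof n h3 _ A hA
  have hup : determinantalComplexity (perPoly (Fin n) ℂ) ≤ 2 ^ n - 1 :=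
    determinantalComplexity_perPoly_le_holds ℂ n (by omega)
  exact subPotentials_at_of_dc_eq (by omega) (le_antisymm hup hlow) s hs

end Summit.ValiantsHypothesis.ValiantsHypothesis.Theorems.RigidMinimalRepsMinimalRepTorusSymmetric

end
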